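import Mathlib
import Summits.ValiantsHypothesis.ValiantsHypothesis.Theorems.GrenetZeonTwoDimCoefficientsPermanentHessianFlat

/-!
# Crux `GrenetZeon.TwoDimCoefficients` (stmt-ValiantsHypothesis-8062) / rung `DualUnipotentThreeHalves` (stmt-24318):
# scaling-closure — PER-GENERICITY AT PERMUTATION POINTS and T4′ (index reduction through a permutation point)

The eighteenth hand closed the decl `DualUnipotentThreeHalves` modulo ONE hypothesis T4
(✓ `dualUnipotentThreeHalves_of_perGenericIndexReduction`, p836227): for a unipotent pencil of nil-index `> n` an
index-reducing linear substitution `T` of small corank TOGETHER WITH a point `T w` at which `per_n` has large Hessian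
rank (the «per-genericity» clause; König subspaces `{row i = 0}` show SOME clause is needed).  This file discharges the
per-genericity clause on an explicit Zariski-dense-orbit family of points: the PERMUTATION MATRICES.

* the PERMUTATION POINT of `τ` is `x_{r,c} = [r = τ c]` (the permutation matrix of `τ` in the tree's `X_{π i, i}` convention;
  written inline as `fun u => if u.1 = τ u.2 then 1 else 0`, no definition introduced);
* ★ `hess0_transl_permPoint_perPoly_apply` — the Hessian of `per_n` at the permutation point `P_τ` is the `0/1` pattern
  `H_{(c,d),(a,b)} = [b ≠ d]·([a = τ b ∧ c = τ d] + [a = τ d ∧ c = τ b])` (from the tree's `hess0_transl_perPoly`: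
  the `(n−2)`-sub-permanents of a permutation matrix);
* ★ `hess0_transl_permPoint_perPoly_mulVec` / `…_mulVec_injective` — `(H v)_{(c,d)} = Σ_{b ≠ d} v_{τb,b}` if `c = τ d`,
  `= v_{τ d, τ⁻¹ c}` otherwise; injective for `n ≠ 1` (the diagonal block is `J − 1`);
* ★★ `rank_hess0_transl_permPoint_perPoly` — `rank Hess per_n (P_τ) = n²` for `n ≥ 2` (every permutation
  point is a FULL-RANK point of the Hessian of the permanent; compare the Mignon–Ressayre point ✓ `rank_mrHess`, which
  lies ON the hypersurface but has no zero entries);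
* consequence (sibling file `…ScalingPermPointConditional`): T4′ ⟹ the 3/2 rung and the route decl BY NAME, where T4′
  is T4 with the Hessian clause REPLACED by «the image of `T` contains a permutation point» — a PURE INDEX-COST statement.

HONEST FRAMING: an unconditional, route-independent computation about the permanent (no Theses import); it closes no
stub: `DualUnipotentBound`, crux 8062, the 24318 decl and `VP ≠ VNP` remain open.

References: T. Mignon, N. Ressayre, Int. Math. Res. Not. 2004:79, §3 (second partials of the permanent are
sub-permanents; via the tree); J. M. Landsberg, *Geometry and Complexity Theory* (2017), §6.4.6; folklore.
-/

-- single-conjunct layout `Summits/ValiantsHypothesis/ValiantsHypothesis`: the duplicated namespace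
-- component is mandated by the tree.
set_option linter.dupNamespace false
set_option autoImplicit false

noncomputable section

namespace Summit.ValiantsHypothesis.ValiantsHypothesis.Theorems.GrenetZeonTwoDimCoefficients.ScalingClosure

open MvPolynomial Matrix
open Literature.Computability.AlgebraicComplexity
open Summit.ValiantsHypothesis.ValiantsHypothesis.Cruxes.TwoDimCoefficients.DimTwoCases

/-! ### Permutation points and the Hessian of the permanent there -/

section PermPoint

variable {n : ℕ}

/-- ★ **The Hessian of `per_n` at a permutation point.**  The entry `((c,d),(a,b))` of `Hess per_n (P_τ)`
is `1` if `b ≠ d` and either `(a, c) = (τ b, τ d)` or `(a, c) = (τ d, τ b)`, and `0` otherwise: the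
`(n−2) × (n−2)` sub-permanent of a permutation matrix with rows `a, c` and columns `b, d` removed counts the
permutations through the remaining ones. [cite: MignonRessayre2004, §3 — via the tree; folklore] -/
theorem hess0_transl_permPoint_perPoly_apply (τ : Equiv.Perm (Fin n)) (a b c d : Fin n) :
    hess0 (transl (fun u : Fin n × Fin n => if u.1 = τ u.2 then (1 : ℂ) else 0) (perPoly (Fin n) ℂ)) (c, d) (a, b) =
      if d ≠ b ∧ ((a = τ b ∧ c = τ d) ∨ (a = τ d ∧ c = τ b)) then 1 else 0 := by
  classical
  rw [hess0_transl_perPoly]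
  -- the product along `π` off `{b, d}` is the indicator of «`π` agrees with `τ` off `{b, d}`»
  have hprod : ∀ π : Equiv.Perm (Fin n),
      (∏ i ∈ (Finset.univ.erase b).erase d, (fun u : Fin n × Fin n => if u.1 = τ u.2 then (1 : ℂ) else 0) (π i, i)) =
        if (∀ i, i ≠ b → i ≠ d → π i = τ i) then 1 else 0 := by
    intro π
    by_cases h : ∀ i, i ≠ b → i ≠ d → π i = τ i
    · rw [if_pos h]
      refine Finset.prod_eq_one fun i hi => ?_
      have hi' : i ≠ d ∧ i ≠ b := by simpa [Finset.mem_erase] using hi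
      dsimp only
      rw [if_pos (h i hi'.2 hi'.1)]
    · rw [if_neg h]
      push Not at h
      obtain ⟨i, hib, hid, hne⟩ := h
      refine Finset.prod_eq_zero (i := i) (by simp [Finset.mem_erase, hib, hid]) ?_
      dsimp only
      rw [if_neg hne]
  simp_rw [hprod]
  by_cases hdb : d ≠ b
  · -- only `τ` and `τ ∘ (b d)` contribute
    have hne : τ ≠ τ * Equiv.swap b d := by
      intro h
      have h1 : Equiv.swap b d = 1 := mul_eq_left.mp h.symm
      exact hdb (Equiv.swap_eq_refl_iff.mp h1).symm
    -- the two (mutually exclusive) patterns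
    have hexcl : ¬ ((a = τ b ∧ c = τ d) ∧ (a = τ d ∧ c = τ b)) := by
      rintro ⟨⟨h1, -⟩, ⟨h2, -⟩⟩
      exact hdb (τ.injective (h2.symm.trans h1))
    -- the term at `τ`
    have hτ : (if τ b = a ∧ d ≠ b ∧ τ d = c then
        (if (∀ i, i ≠ b → i ≠ d → τ i = τ i) then (1 : ℂ) else 0) else 0) =
        if (a = τ b ∧ c = τ d) then 1 else 0 := by
      rw [if_pos (fun _ _ _ => rfl)]
      by_cases h : a = τ b ∧ c = τ d
      · rw [if_pos ⟨h.1.symm, hdb, h.2.symm⟩, if_pos h]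
      · rw [if_neg (fun h' => h ⟨h'.1.symm, h'.2.2.symm⟩), if_neg h]
    -- the term at `τ ∘ (b d)`
    have hgσ : ∀ i, i ≠ b → i ≠ d → (τ * Equiv.swap b d) i = τ i := fun i h1 h2 => by
      rw [Equiv.Perm.mul_apply, Equiv.swap_apply_of_ne_of_ne h1 h2]
    have hσb : (τ * Equiv.swap b d) b = τ d := by
      rw [Equiv.Perm.mul_apply, Equiv.swap_apply_left]
    have hσd : (τ * Equiv.swap b d) d = τ b := by
      rw [Equiv.Perm.mul_apply, Equiv.swap_apply_right]
    have hσ : (if (τ * Equiv.swap b d) b = a ∧ d ≠ b ∧ (τ * Equiv.swap b d) d = c then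
        (if (∀ i, i ≠ b → i ≠ d → (τ * Equiv.swap b d) i = τ i) then (1 : ℂ) else 0) else 0) =
        if (a = τ d ∧ c = τ b) then 1 else 0 := by
      rw [if_pos hgσ, hσb, hσd]
      by_cases h : a = τ d ∧ c = τ b
      · rw [if_pos ⟨h.1.symm, hdb, h.2.symm⟩, if_pos h]
      · rw [if_neg (fun h' => h ⟨h'.1.symm, h'.2.2.symm⟩), if_neg h]
    rw [← Finset.sum_subset (Finset.subset_univ ({τ, τ * Equiv.swap b d} : Finset _)),
      Finset.sum_pair hne]
    · -- evaluate the two terms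
      rw [hτ, hσ]
      by_cases h1 : a = τ b ∧ c = τ d
      · have h2 : ¬ (a = τ d ∧ c = τ b) := fun h2 => hexcl ⟨h1, h2⟩
        rw [if_pos h1, if_neg h2, if_pos ⟨hdb, Or.inl h1⟩, add_zero]
      · by_cases h2 : a = τ d ∧ c = τ b
        · rw [if_neg h1, if_pos h2, if_pos ⟨hdb, Or.inr h2⟩, zero_add]
        · rw [if_neg h1, if_neg h2, if_neg (fun h => h.2.elim h1 h2), add_zero]
    · intro π _ hπ
      by_cases hP : π b = a ∧ d ≠ b ∧ π d = c
      · rw [if_pos hP, if_neg]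
        intro hall
        apply hπ
        rcases perm_eq_or_eq_mul_swap_of_agree π τ (Ne.symm hdb) hall with rfl | rfl
        · simp
        · simp
      · rw [if_neg hP]
  · -- `d = b`: everything vanishes
    rw [if_neg (fun h => hdb h.1)]
    refine Finset.sum_eq_zero fun π _ => ?_
    rw [if_neg]
    rintro ⟨-, h, -⟩
    exact hdb h

/-- ★ **The Hessian at a permutation point, applied to a vector.**  `(H v)_{(c,d)} = Σ_{b ≠ d} v_{τ b, b}` if
`c = τ d` (the «diagonal» block `J − 1` on the support of `τ`), and `= v_{τ d, τ⁻¹ c}` otherwise (the swap block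
pairing the coordinate `(c, d)` with `(τ d, τ⁻¹ c)`). [folklore] -/
theorem hess0_transl_permPoint_perPoly_mulVec (τ : Equiv.Perm (Fin n)) (v : Fin n × Fin n → ℂ) (c d : Fin n) :
    (hess0 (transl (fun u : Fin n × Fin n => if u.1 = τ u.2 then (1 : ℂ) else 0) (perPoly (Fin n) ℂ))).mulVec v (c, d) =
      if c = τ d then ∑ b ∈ Finset.univ.erase d, v (τ b, b) else v (τ d, τ⁻¹ c) := by
  classical
  have hτi : ∀ x, τ (τ⁻¹ x) = x := fun x => τ.apply_symm_apply x
  have hiτ : ∀ x, τ⁻¹ (τ x) = x := fun x => τ.symm_apply_apply x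
  rw [Matrix.mulVec, dotProduct, ← Finset.univ_product_univ, Finset.sum_product_right]
  simp_rw [hess0_transl_permPoint_perPoly_apply]
  by_cases hcd : c = τ d
  · rw [if_pos hcd]
    -- at fixed `b ≠ d` the inner sum over `a` picks `a = τ b`; at `b = d` it vanishes
    have hinner : ∀ b : Fin n,
        (∑ a : Fin n, (if d ≠ b ∧ ((a = τ b ∧ c = τ d) ∨ (a = τ d ∧ c = τ b)) then (1 : ℂ) else 0) *
          v (a, b)) = if b ≠ d then v (τ b, b) else 0 := by
      intro b
      by_cases hbd : b ≠ d
      · rw [if_pos hbd, Finset.sum_eq_single (τ b)]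
        · rw [if_pos ⟨hbd.symm, Or.inl ⟨rfl, hcd⟩⟩, one_mul]
        · intro a _ ha
          rw [if_neg, zero_mul]
          rintro ⟨-, h | h⟩
          · exact ha h.1
          · exact hbd (τ.injective (h.2.symm.trans hcd))
        · intro h; exact absurd (Finset.mem_univ _) h
      · rw [if_neg hbd]
        push Not at hbd
        refine Finset.sum_eq_zero fun a _ => ?_
        rw [if_neg (fun h => h.1 hbd.symm), zero_mul]
    rw [Finset.sum_congr rfl fun b _ => hinner b, ← Finset.sum_filter, Finset.filter_ne']
  · rw [if_neg hcd]
    -- only the coordinate `(τ d, τ⁻¹ c)` survives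
    have hb₀d : τ⁻¹ c ≠ d := fun h => hcd (by rw [← h, hτi])
    rw [Finset.sum_eq_single (τ⁻¹ c)]
    · rw [Finset.sum_eq_single (τ d)]
      · rw [if_pos ⟨hb₀d.symm, Or.inr ⟨rfl, (hτi c).symm⟩⟩, one_mul]
      · intro a _ ha
        rw [if_neg, zero_mul]
        rintro ⟨-, h | h⟩
        · exact hcd h.2
        · exact ha h.1
      · intro h; exact absurd (Finset.mem_univ _) h
    · intro b _ hb
      refine Finset.sum_eq_zero fun a _ => ?_
      rw [if_neg, zero_mul]
      rintro ⟨-, h | h⟩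
      · exact hcd h.2
      · exact hb (by rw [h.2, hiτ])
    · intro h; exact absurd (Finset.mem_univ _) h

/-- ★ **The Hessian of `per_n` at a permutation point is injective** (`n ≠ 1`): the swap blocks are involutions and the
diagonal block `J − 1` is invertible in characteristic `0`. [folklore] -/
theorem hess0_transl_permPoint_perPoly_mulVec_injective (hn : n ≠ 1) (τ : Equiv.Perm (Fin n)) :
    Function.Injective (hess0 (transl (fun u : Fin n × Fin n => if u.1 = τ u.2 then (1 : ℂ) else 0) (perPoly (Fin n) ℂ))).mulVec := by
  classical
  have hτi : ∀ x, τ (τ⁻¹ x) = x := fun x => τ.apply_symm_apply x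
  have hiτ : ∀ x, τ⁻¹ (τ x) = x := fun x => τ.symm_apply_apply x
  set H := hess0 (transl (fun u : Fin n × Fin n => if u.1 = τ u.2 then (1 : ℂ) else 0) (perPoly (Fin n) ℂ)) with hH
  -- it suffices to show `H v = 0 → v = 0`
  suffices hker : ∀ v, H.mulVec v = 0 → v = 0 by
    intro v w hvw
    have h := hker (v - w) (by rw [Matrix.mulVec_sub, hvw, sub_self])
    exact sub_eq_zero.mp h
  intro v hv
  have hrow : ∀ c d, (if c = τ d then ∑ b ∈ Finset.univ.erase d, v (τ b, b) else v (τ d, τ⁻¹ c)) = 0 := by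
    intro c d
    rw [← hess0_transl_permPoint_perPoly_mulVec τ v c d, ← hH, hv, Pi.zero_apply]
  -- off the support of `τ`
  have hoff : ∀ r b, r ≠ τ b → v (r, b) = 0 := by
    intro r b hrb
    have h := hrow (τ b) (τ⁻¹ r)
    rw [hτi, if_neg (fun h' : τ b = r => hrb h'.symm), hiτ] at h
    exact h
  -- on the support of `τ`: `(J − 1) w = 0` with `w_b = v (τ b, b)`
  have hdiag : ∀ d, ∑ b ∈ Finset.univ.erase d, v (τ b, b) = 0 := fun d => by
    have h := hrow (τ d) d
    rwa [if_pos rfl] at h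
  set S := ∑ b, v (τ b, b) with hS
  have hwS : ∀ d, v (τ d, d) = S := fun d => by
    have h := hdiag d
    rw [hS, ← Finset.sum_erase_add _ _ (Finset.mem_univ d), h, zero_add]
  have hS0 : S = 0 := by
    have h : S = (n : ℂ) * S := by
      conv_lhs => rw [hS]
      simp_rw [hwS]
      rw [Finset.sum_const, Finset.card_univ, Fintype.card_fin, nsmul_eq_mul]
    have hn1 : (n : ℂ) - 1 ≠ 0 := by
      rw [sub_ne_zero]
      exact_mod_cast hn
    have h' : ((n : ℂ) - 1) * S = 0 := by rw [sub_mul, one_mul, ← h, sub_self]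
    exact (mul_eq_zero.mp h').resolve_left hn1
  funext ⟨r, b⟩
  by_cases hrb : r = τ b
  · rw [hrb, hwS, hS0, Pi.zero_apply]
  · rw [Pi.zero_apply]; exact hoff r b hrb

/-- ★★ **Every permutation point is a full-rank point of the Hessian of the permanent**: for `n ≥ 2`,
`rank Hess per_n (P_τ) = n²`.  (Compare ✓ `rank_mrHess`: the Mignon–Ressayre point lies ON `{per_n = 0}` but has
no zero entries; the permutation points have `n² − n` zero entries, which is what coordinate / pattern substitutions need.)
[cite: MignonRessayre2004, §3 — via the tree; folklore] -/
theorem rank_hess0_transl_permPoint_perPoly (hn : 2 ≤ n) (τ : Equiv.Perm (Fin n)) :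
    (hess0 (transl (fun u : Fin n × Fin n => if u.1 = τ u.2 then (1 : ℂ) else 0) (perPoly (Fin n) ℂ))).rank = n ^ 2 := by
  rw [Matrix.rank_of_isUnit _ (Matrix.mulVec_injective_iff_isUnit.mp
    (hess0_transl_permPoint_perPoly_mulVec_injective (by omega) τ)), Fintype.card_prod, Fintype.card_fin, sq]

end PermPoint

end Summit.ValiantsHypothesis.ValiantsHypothesis.Theorems.GrenetZeonTwoDimCoefficients.ScalingClosure

end
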